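import Summits.ResolutionOfSingularities.ResolutionOfSingularities.Theorems.KGener
import Summits.ResolutionOfSingularities.ResolutionOfSingularities.Theorems.FrameStep3
import Summits.ResolutionOfSingularities.ResolutionOfSingularities.Theorems.IsoDict2

/-!
# KGenerFrame — the frame end of the isolation transport (Layer D3 of the tower dictionary, `K`-side)

0-weight TOOL toward `TightDefectClasses.TowerDictionary` (decomp-res lens-5, g39; plan `NEXT-g40.md` §6 D3 = (ZN-gen)); companion of `KGener`.
§1 A subring `S ⊆ L'` GIVEN BY FRAMES (`x ∈ S ↔ x = θ a / θ s`, `s(0) ≠ 0` — e.g. `frameRing θ`, or the carrier `B̃_i` once `frameRing θ_i = B̃_i` is known) is the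
localisation `K[Z,u]_{(Z,u)}` for the structure map `toSubring` (`isLocalization_of_frames`; `(Z,u)` prime as an instance binder, discharged in §3 by `FrameStep.idealOfVars_isMaximal`); hence a prime `𝔓 ⊊ (Z,u)` with a symbolic membership
`s·P ∈ 𝔓ⁿ` pushes to a prime `Q` of `S` MISSING A NON-UNIT (so `Q ≠ 𝔪_S`) with `t·θ(P) ∈ Qⁿ` (`exists_prime_symb_of_frames`, via `KGener.symb_map_of_disjoint`).
§2 The `K`-side package: for `F ∈ K[u₁…uₙ]`, `F(0) = 0`, `¬ IsolatedTop pᵉ F` there is a prime `𝔓 ⊊ (Z,u)` of `K[Z,u]` (indexing `Option (Fin n)`) with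
`Z^{pᵉ} + F ∈ 𝔓^{(pᵉ)}` (`exists_prime_symb_framePoly`: landed `IsoDict.exists_prime_of_not_isolatedTop` + `exists_prime_over_le_idealOfVars` + `hypZ_mem_symbPow`,
renamed along `Fin (n+1) ≃ Option (Fin n)`).  §3 Both composed (`exists_prime_symb_frame_of_not_isolatedTop`).
All PROVED, 0 sorry.  [cite: Matsumura1987, Thm. 4.1 / §6]; [cite: EGAIV4, Thm. 16.11.2]; [cite: AtiyahMacdonald1969, Ch. 5, Thm. 5.11].
-/

noncomputable section

set_option linter.dupNamespace false

namespace Summit.ResolutionOfSingularities.ResolutionOfSingularities.Theorems.KGenerFrame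

open MvPolynomial IsLocalRing
open Summit.ResolutionOfSingularities.ResolutionOfSingularities.Theorems.FrameStep
open Summit.ResolutionOfSingularities.ResolutionOfSingularities.Theorems.TightDefectClasses (IsolatedTop topIdeal)
open Summit.ResolutionOfSingularities.ResolutionOfSingularities.Theorems.IsoDict (hypZ hypZ_mem_symbPow
  exists_prime_of_not_isolatedTop comap_rename_succ_idealOfVars exists_prime_over_le_idealOfVars)

/-! ## §1 A subring given by frames is the localisation `K[Z,u]_{(Z,u)}` -/

section Frames

variable {σ : Type} {K : Type} [Field K] {L : Type} [Field L] [Algebra K L]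
  (S : Subring L) (θ : MvPolynomial (Option σ) K →ₐ[K] L) (hθ : Function.Injective θ)
  (hS : ∀ x : L, x ∈ S ↔ ∃ a s : MvPolynomial (Option σ) K, s ∉ idealOfVars (Option σ) K ∧ x = θ a / θ s)

/-- The structure map `K[Z,u] → S`, `a ↦ θ a` (`θ a = θ a / θ 1 ∈ S`). DEFINITION (support, data). -/
def toSubring : MvPolynomial (Option σ) K →+* S :=
  θ.toRingHom.codRestrict S fun a =>
    show θ a ∈ S from (hS (θ a)).mpr ⟨a, 1, one_not_mem_idealOfVars, by rw [map_one, div_one]⟩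

/-- `toSubring a = θ a` in `L`. -/
theorem coe_toSubring (a : MvPolynomial (Option σ) K) : ((toSubring S θ hS a : S) : L) = θ a := rfl

include hθ in
/-- **A subring given by frames is `K[Z,u]_{(Z,u)}`**: `IsLocalization.AtPrime S (Z,u)` for the structure map `toSubring` (units: `θ 1 / θ s`; surjectivity:
the frame description `hS`; exactness: injectivity of `θ`). [cite: Matsumura1987, Thm. 4.1 / §6] -/
theorem isLocalization_of_frames [(idealOfVars (Option σ) K).IsPrime] :
    letI := (toSubring S θ hS).toAlgebra; IsLocalization.AtPrime S (idealOfVars (Option σ) K) := by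
  letI := (toSubring S θ hS).toAlgebra
  have hθne : ∀ {s : MvPolynomial (Option σ) K}, s ∉ idealOfVars (Option σ) K → θ s ≠ 0 := fun {s} hs h0 =>
    hs (by rw [hθ (h0.trans (map_zero θ).symm)]; exact Ideal.zero_mem _)
  refine ⟨?_, ?_, ?_⟩
  · rintro ⟨y, hy⟩
    have hinv : (θ y)⁻¹ ∈ S := (hS _).mpr ⟨1, y, hy, by rw [map_one, one_div]⟩
    refine IsUnit.of_mul_eq_one ⟨(θ y)⁻¹, hinv⟩ (Subtype.ext ?_)
    change θ y * (θ y)⁻¹ = 1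
    exact mul_inv_cancel₀ (hθne hy)
  · rintro ⟨x, hx⟩
    obtain ⟨a, s, hs, rfl⟩ := (hS x).mp hx
    refine ⟨(a, ⟨s, hs⟩), Subtype.ext ?_⟩
    change θ a / θ s * θ s = θ a
    exact div_mul_cancel₀ _ (hθne hs)
  · intro a b h
    have h1 : θ a = θ b := congrArg Subtype.val h
    exact ⟨1, by rw [hθ h1]⟩

include hθ in
/-- **PUSH INTO THE FRAME RING**: a prime `𝔓 ⊊ (Z,u)` of `K[Z,u]` with `s·P ∈ 𝔓ⁿ` (`s ∉ 𝔓`) gives a prime `Q = 𝔓·S` of `S` which misses a NON-UNIT of `S`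
(namely `θ(X o)` for a variable `X o ∉ 𝔓` — so `Q ≠ 𝔪_S`) and `t·θ(P) ∈ Qⁿ` for some `t ∉ Q`. [cite: Matsumura1987, Thm. 4.1 / §6] -/
theorem exists_prime_symb_of_frames [(idealOfVars (Option σ) K).IsPrime] {𝔓 : Ideal (MvPolynomial (Option σ) K)} (h𝔓 : 𝔓.IsPrime)
    (hle : 𝔓 ≤ idealOfVars (Option σ) K) (hne : 𝔓 ≠ idealOfVars (Option σ) K) {n : ℕ} {P : MvPolynomial (Option σ) K}
    (h : ∃ s ∉ 𝔓, s * P ∈ 𝔓 ^ n) :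
    ∃ Q : Ideal S, Q.IsPrime ∧ (∃ y : S, ¬ IsUnit y ∧ y ∉ Q) ∧ ∃ t ∉ Q, t * toSubring S θ hS P ∈ Q ^ n := by
  letI := (toSubring S θ hS).toAlgebra
  haveI := isLocalization_of_frames S θ hθ hS
  have hd : Disjoint ((idealOfVars (Option σ) K).primeCompl : Set (MvPolynomial (Option σ) K)) (𝔓 : Set _) := by
    rw [Set.disjoint_left]
    intro y hy hy'
    exact hy (hle hy')
  have hX : ∃ o : Option σ, (X o : MvPolynomial (Option σ) K) ∉ 𝔓 := by
    by_contra hall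
    simp only [not_exists, not_not] at hall
    apply hne
    refine le_antisymm hle (Ideal.span_le.mpr ?_)
    rintro _ ⟨o, rfl⟩
    exact hall o
  obtain ⟨o, ho⟩ := hX
  refine ⟨𝔓.map (algebraMap _ S), IsLocalization.isPrime_of_isPrime_disjoint (idealOfVars (Option σ) K).primeCompl S 𝔓 h𝔓 hd,
    ⟨algebraMap (MvPolynomial (Option σ) K) S (X o), fun hu => ?_, fun hmem => ho ?_⟩,
    KGener.symb_map_of_disjoint (idealOfVars (Option σ) K).primeCompl h𝔓 hd h⟩
  · exact ((IsLocalization.AtPrime.isUnit_to_map_iff S (idealOfVars (Option σ) K) (X o)).mp hu)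
      ((mem_idealOfVars_iff _).mpr (constantCoeff_X K o))
  · have h1 : (X o : MvPolynomial (Option σ) K) ∈ (𝔓.map (algebraMap _ S)).under _ := Ideal.mem_comap.mpr hmem
    rwa [IsLocalization.under_map_of_isPrime_disjoint (idealOfVars (Option σ) K).primeCompl S h𝔓 hd] at h1

-- For `S = frameRing θ hθ` itself the frame description `hS` is landed `FrameStep.mem_frameRing_iff θ hθ` (by name; not restated).

end Frames

/-! ## §2 The `K`-side package: a prime `𝔓 ⊊ (Z,u)` with `Z^{pᵉ} + F ∈ 𝔓^{(pᵉ)}` from non-isolation -/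

section KSide

variable {K : Type} [Field K] {p : ℕ} {n : ℕ}

/-- Renaming `Fin (n+1) ≃ Option (Fin n)` (`0 ↦ none`, `i.succ ↦ some i`) carries `hypZ q F = X 0 ^ q + F(u)` to `framePoly q F = X none ^ q + F(u)`. -/
theorem rename_finSuccEquiv_hypZ (q : ℕ) (F : MvPolynomial (Fin n) K) :
    rename (finSuccEquiv n) (hypZ q F) = framePoly q F := by
  show rename (finSuccEquiv n) (X 0 ^ q + rename Fin.succ F) = X none ^ q + rename some F
  rw [map_add, map_pow, rename_X, finSuccEquiv_zero, rename_rename]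
  have h1 : (finSuccEquiv n) ∘ Fin.succ = some := funext fun i => finSuccEquiv_succ i
  rw [h1]

/-- **THE `K`-SIDE PACKAGE** (`K` perfect of characteristic `p`, `F(0) = 0`): if the origin is NOT an isolated point of the top locus of `F` (`¬ IsolatedTop pᵉ F`),
there is a prime `𝔓 ⊊ (Z,u)` of `K[Z,u]` with `s·(Z^{pᵉ} + F) ∈ 𝔓^{pᵉ}` for some `s ∉ 𝔓` — landed `IsoDict.exists_prime_of_not_isolatedTop` (a prime
`J_F ⊆ 𝔭 ⊊ (u)`), `exists_prime_over_le_idealOfVars` (going-up to `𝔓 ∋ Z^{pᵉ}+F`), `hypZ_mem_symbPow` (Zariski–Nagata with Hasse–Schmidt derivatives), renamed to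
the `Option (Fin n)` indexing of the frames. [cite: EGAIV4, Thm. 16.11.2]; [cite: AtiyahMacdonald1969, Ch. 5, Thm. 5.11] -/
theorem exists_prime_symb_framePoly [DecidableEq K] [PerfectField K] [CharP K p] (hp : p.Prime) (e : ℕ) (F : MvPolynomial (Fin n) K)
    (hF0 : constantCoeff F = 0) (h : ¬ IsolatedTop (p ^ e) F) :
    ∃ 𝔓 : Ideal (MvPolynomial (Option (Fin n)) K), 𝔓.IsPrime ∧ 𝔓 ≤ idealOfVars (Option (Fin n)) K ∧
      𝔓 ≠ idealOfVars (Option (Fin n)) K ∧ ∃ s ∉ 𝔓, s * framePoly (p ^ e) F ∈ 𝔓 ^ (p ^ e) := by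
  have hq : p ^ e ≠ 0 := pow_ne_zero e hp.ne_zero
  obtain ⟨𝔭, h𝔭, htop, h𝔭le, h𝔭ne⟩ := exists_prime_of_not_isolatedTop h
  obtain ⟨𝔓, h𝔓, hZ, hcomap, h𝔓le⟩ := exists_prime_over_le_idealOfVars hq F hF0 h𝔭 h𝔭le
  haveI := h𝔓
  have hJ : (topIdeal (p ^ e) F).map (rename Fin.succ) ≤ 𝔓 := by
    rw [Ideal.map_le_iff_le_comap, hcomap]
    exact htop
  have hmem : ∃ s ∉ 𝔓, s * hypZ (p ^ e) F ∈ 𝔓 ^ (p ^ e) := hypZ_mem_symbPow hp e F hZ hJ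
  obtain ⟨s, hs, hsZ⟩ := hmem
  have h𝔓ne : 𝔓 ≠ idealOfVars (Fin (n + 1)) K := by
    rintro rfl
    exact h𝔭ne (by rw [← hcomap, comap_rename_succ_idealOfVars])
  let ρ : MvPolynomial (Fin (n + 1)) K ≃+* MvPolynomial (Option (Fin n)) K := (renameEquiv K (finSuccEquiv n)).toRingEquiv
  have hρ : ∀ z, ρ z = rename (finSuccEquiv n) z := fun z => rfl
  have hρs : ∀ y, ρ.symm y = rename (finSuccEquiv n).symm y := fun y => rfl
  have hcc : ∀ y, constantCoeff (ρ.symm y) = constantCoeff y := fun y => by rw [hρs, constantCoeff_rename]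
  have hcc' : ∀ z, constantCoeff (ρ z) = constantCoeff z := fun z => by rw [hρ, constantCoeff_rename]
  have hρZ : ρ.symm (framePoly (p ^ e) F) = hypZ (p ^ e) F := by
    rw [← rename_finSuccEquiv_hypZ, ← hρ, RingEquiv.symm_apply_apply]
  refine ⟨𝔓.comap ρ.symm, inferInstance, ?_, ?_, KGener.symb_comap_equiv ρ.symm 𝔓 ⟨s, hs, by rw [hρZ]; exact hsZ⟩⟩
  · intro y hy
    rw [Ideal.mem_comap] at hy
    rw [mem_idealOfVars_iff, ← hcc y]
    exact (mem_idealOfVars_iff _).mp (h𝔓le hy)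
  · intro heq
    apply h𝔓ne
    ext z
    constructor
    · intro hz
      have h1 : ρ z ∈ 𝔓.comap ρ.symm := by
        rw [Ideal.mem_comap, RingEquiv.symm_apply_apply]
        exact hz
      rw [heq, mem_idealOfVars_iff, hcc'] at h1
      exact (mem_idealOfVars_iff _).mpr h1
    · intro hz
      have h1 : ρ z ∈ idealOfVars (Option (Fin n)) K :=
        (mem_idealOfVars_iff _).mpr (by rw [hcc']; exact (mem_idealOfVars_iff _).mp hz)
      rw [← heq, Ideal.mem_comap, RingEquiv.symm_apply_apply] at h1
      exact h1

end KSide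

/-! ## §3 Composition: from non-isolation of the `K`-stage to a bad prime of the frame ring -/

section Compose

variable {K : Type} [Field K] {p : ℕ} {n : ℕ} {L : Type} [Field L] [Algebra K L]
  (S : Subring L) (θ : MvPolynomial (Option (Fin n)) K →ₐ[K] L) (hθ : Function.Injective θ)
  (hS : ∀ x : L, x ∈ S ↔ ∃ a s : MvPolynomial (Option (Fin n)) K, s ∉ idealOfVars (Option (Fin n)) K ∧ x = θ a / θ s)

include hθ in
/-- **D3, `K`-side ⇒ frame side**: `¬ IsolatedTop pᵉ F` (`F(0) = 0`) yields a prime `Q` of the frame-given ring `S` missing a non-unit (`Q ≠ 𝔪_S`) with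
`t·θ(Z^{pᵉ} + F) ∈ Q^{pᵉ}`, `t ∉ Q`.  Layer E continues with `KGener.symb_mul_left` (unit factor), `symb_under` (down to `B_i ⊗ K`), `symb_under_tensor`, `eq_of_under_eq_maximalIdeal`,
`symb_comap_equiv` (`ψ_i`) and `ForcedTower.absurd_of_symb`. -/
theorem exists_prime_symb_frame_of_not_isolatedTop [DecidableEq K] [PerfectField K] [CharP K p] (hp : p.Prime) (e : ℕ)
    (F : MvPolynomial (Fin n) K) (hF0 : constantCoeff F = 0) (h : ¬ IsolatedTop (p ^ e) F) :
    ∃ Q : Ideal S, Q.IsPrime ∧ (∃ y : S, ¬ IsUnit y ∧ y ∉ Q) ∧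
      ∃ t ∉ Q, t * toSubring S θ hS (framePoly (p ^ e) F) ∈ Q ^ (p ^ e) := by
  haveI : (idealOfVars (Option (Fin n)) K).IsPrime := idealOfVars_isMaximal.isPrime
  obtain ⟨𝔓, h𝔓, hle, hne, hsymb⟩ := exists_prime_symb_framePoly hp e F hF0 h
  exact exists_prime_symb_of_frames S θ hθ hS h𝔓 hle hne hsymb

end Compose

end Summit.ResolutionOfSingularities.ResolutionOfSingularities.Theorems.KGenerFrame
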